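/-
Copyright: lit-balaban Phase-2 proof seat p08 (gen 9).  Statement-level skeleton of a published paper; no proof claims beyond what
the kernel checks below.
-/
import Literature.MathematicalPhysics.QuantumFieldTheory.BalabanImbrieJaffe1984to88.BIJ88OpDecay213DkLocGradTorus
import Literature.MathematicalPhysics.QuantumFieldTheory.BalabanImbrieJaffe1984to88.BIJ88CurlyDkLocCloseTorus
import Literature.MathematicalPhysics.QuantumFieldTheory.BalabanImbrieJaffe1984to88.BIJ85Prop12AllTori

/-!
# `BalabanImbrieJaffe1984to88.BIJ88OpCloseDkLocTorus` — T. Bałaban, J. Imbrie, A. Jaffe, *Effective action and cluster properties of the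
abelian Higgs model*, Commun. Math. Phys. **114** (1988) 257–315 [BalabanImbrieJaffe1988], Sect. 2 p. 261 [PDF 5]: the third clause of the
(2.13) sentence, *"and 𝒟_{k,loc} is close to 𝒟_k, see (5.4.3) below"*, **IN THE PRINTED OPERATOR FORM FOR THE CONCRETE OBJECTS OF RECORD**
— p11's (I.4.4.4) propagator `𝒟_k = DkE P η_k^d L^k k` and r18's (2.12) `𝒟_{k,loc} = dkLocKer (η_k^d) (L^k) ρ k`, with the `η^d`-weighted
action of `BIJ88OpDecay213DkLocTorus`: `|((𝒟_k − 𝒟_{k,loc})f)(b)| ≤ c₀e^{−cρ_k}e^{−δ′dist_k(suppt f,b)}‖f‖_∞` for ALL `b`, NO distance threshold,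
uniformly in `k ≤ m + K`, for every positive radius schedule non-increasing below `k` — the shape of r18's typed (2.31) `OpClose231`, which it
inhabits for `ρ_k` beyond a threshold; per torus with NO hypothesis, and over all tori (one set of constants) hypothesis-free.

statement-level skeleton of published theorems with citation tags; proofs where landed; nothing here is a claim about the Yang–Mills mass gap

PDF held: `paper:balaban1988-cmp114-bij-abelian-higgs-effective-action` (journal page = PDF page + 256), p. 261 [PDF 5]; p. 263 [PDF 7] (2.31)
(the typed operator-closeness shape); p. 282 [PDF 26], the UNNUMBERED `w′₁`-display following (5.4.3) (the use of the clause; the numbered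
(5.4.7) on that page is the analogous `w₂` bound); [6I] = [Balaban1984PropagatorsI] Prop. 1.2.  v1.1 (p08 gen 10, 2026-08-22): docstring-only —
the p. 282 locator relabelled (it was cited as «(5.4.7)»; ref-5 L-g34 (b), lead relay 2026-08-22T02:11:37Z); declarations byte-identical to v1.
v1.2 (p08 gen 10, 2026-08-22): + §5 `opClose_dkLoc_torus_rSched` / `opClose_dkLoc_allTori_rSched` — §§3–4 AT THE PRINTED SCHEDULE `ρ_j = r(e_j)`
(r18's `rSched`), schedule hypotheses discharged by r18's v1.2 `rSched_pos_of_le` / `rSched_anti`; append-only, §§1–4 byte-identical.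

CITATION HEADER (lean-in-tree rule).  Part of the lit-balaban TYPED SKELETON (HOME `run/shared/lean/pub/lit-balaban/`), Phase-2 proof seat
p08 (gen 9), unit `lit-balaban-p08`; free-target protocol G.5-34(d), TAKING line HOME/STATUS.md (item (I)).  WHAT IS REPRODUCED = SKELETON row
**C2.Eq2.13** (owner r18, referee ref-5), third p. 261 clause, kind «model instance», OPERATOR form (the kernel form beyond a threshold is
r18's `BIJ88CurlyDkLocCloseTorus`); it is the `𝒟_k − 𝒟_{k,loc}` input of r16's row C2.Eq5.4.7 (`w′₁`), whose dressing with `∂*ε*δΠ` and the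
output derivative is NOT done here.  Decls used BY NAME (nothing restated): r18's `BIJ88CurlyDkLocCloseTorus.dk_sub_dkLoc_eq_sum`,
`abs_hKer_sub_hlKer_le` ((2.7) for `H_{j,loc} = ζ_jH_j`), `abs_cKer_sub_clKer_ambient_le`, `cSide_of_cloc_estimates`; r18's `BIJ88CurlyDkLocTorus`
(`hKer`, `hlKer`, `cKer`, `clKer`, `dkLocKer`, `kdist`, `cKer_ambient_eq`); this seat's `BIJ88OpDecay213DkLocGradTorus.weighted_rowsum_triple_le₂`,
`BIJ88OpDecay213DkLocTorus.abs_applyK_le_of_weighted_rowsum` / `eta_pow_scaling`, `BIJ88CurlyDkLocDecayTorus.abs_hlKer_le_of_sup` /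
`abs_clKer_ambient_le`; p08 g7's `ofLp_HkE_single` / `exists_bound_of_ineq722`; p09's `cloc_estimates`, `ineq722_deltaA_of_prop12Printed`;
p16's `prop12Printed_levStd_deltaA`, `exists_absH_le_allTori_of_prop12Printed`, `abs_H_zero_le`; p19's `prop12Printed_allTori`; r18's typed
`BIJ88Sect2Statements.OpClose231` / `applyK` / `supNorm` / `suppDist`.

THE PRINTED TEXT (p. 261 [PDF 5], verbatim): *"Thus |(𝒟_{k,loc}f)(b)| ≦ ce^{−c dist(suppt f,b)}‖f‖_∞ (2.13) … Furthermore, 𝒟_{k,loc}(b₁,b₂) = 0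
for dist(b₁,b₂) ≧ ½r(e_k), and 𝒟_{k,loc} is close to 𝒟_k, see (5.4.3) below."*; p. 263 (2.31) *"|(G_{k,loc}(u)f − G_k(Ω,u)f)(x)| ≦
e^{−cr(e_k)}e^{−c dist(suppt f,x)}‖f‖_∞"* (the operator-closeness shape, r18's `OpClose231`); p. 260 (2.7) *"|H_{k,loc}(b,b′) − H_k(b,b′)| ≦
e^{−cr(e_k)}e^{−c dist(b,b′)}"*; p. 282, the unnumbered display after (5.4.3) (the `w′₁` bound)
*"≦ Σ_j(L^jη)^{…}e^{−cr(e_j)}e^{−c dist(p,b′)} ≦ e^{−cr(e_k)}e^{−c dist(p,b′)}"* (the numbered (5.4.7) below it is the `w₂` bound of the same shape).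

THE MECHANISM (r18's telescoping, this seat's weighted row sums).  Per scale `H C H − H_lC_lH_l = (H − H_l)CH + H_l(C − C_l)H + H_lC_l(H − H_l)`;
the small factors are `|H_j − H_{j,loc}| ≤ Me^{−(δ/2)(ρ_j/16)}e^{−(δ/2)dist}` ((2.7), `ζ_j = 1` within `ρ_j/16`) and `|C^{(j)} − C^{(j)}_{loc}| ≤
M_Ce^{−(δ_C/4)ρ_j}e^{−δ_C|·|}` (p09's (2.7)-analogue at `R = ρ_j/4`); each product's `η^d`-weighted row sum against `e^{a·dist_k}` is
`≲ (L^{k−j})^{−2}` (`weighted_rowsum_triple_le₂` and `η_k^d(L^{k−j})^{d−2}(L^j)^d = (L^{k−j})^{−2}`), so the scale sum needs no threshold and carries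
`2e^{−(δ/32)ρ_j} + e^{−(δ_C/4)ρ_j} ≤ 3e^{−cρ_k}` for a non-increasing schedule.

WHAT IS PROVED (0 `sorry`, standard axioms; theorems only — proof lane; every `d ≥ 2`):
* §1 `weighted_rowsum_diffTerm_le` (scale `j`: `Σ_{b″}η_k^d|[H_jC^{(j)}H_j − H_{j,loc}C^{(j)}_{loc}H_{j,loc}](b,b″)|e^{a·dist_k(b″,b)} ≤
  (2e^{−(δ/2)(r/16)} + e^{−(δ_C/4)r})M²M_C·d³e^{a/2}K(a)³·(L^{k−j})^{−2}`, `a = min(δ/2,δ_C)/2`), **`weighted_rowsum_dkSubDkLoc_le`** (`Σ_{b″}η_k^d|𝒟_k(b,b″) −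
  𝒟_{k,loc}(b,b″)|e^{a·dist_k(b″,b)} ≤ 3M²M_C·d³e^{a/2}K(a)³·e^{−cρ_k}`, `c = min(δ/32,δ_C/4)`, every `k ≤ m + K`, schedule positive and non-increasing below `k`).
* §2 **`abs_apply_dkSubDkLoc_le`** (explicit, ALL `b`: `|((𝒟_k − 𝒟_{k,loc})f)(b)| ≤ 3M²M_C·d³e^{a/2}K(a)³·e^{−cρ_k}·e^{−a·dist_k(suppt f,b)}‖f‖_∞`),
  `opClose_dkLoc_of_ineq722`, **`opClose_dkLoc_torus`** (NO HYPOTHESIS: `∃ c₀ c δ′, 0 < c ∧ 0 < δ′ ∧ 0 ≤ c₀ ∧ ∀ k ≤ m + K ∀ ρ` positive and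
  non-increasing below `k`, `∀ f b`, the bound), **`opClose231_dkLoc_torus`** (r18's typed `OpClose231 (κ·dist_k) ⊤ (η^d𝒟_{k,loc}) (η^d𝒟_k) c (ρ_k)` for
  `ρ_k ≥ ρ_*`).
* §3 **`opClose_dkLoc_allTori_of_prop12Printed`** (ONE `(c₀, c, δ′)` for every torus `(P.d = d, P.L = L)` from the all-tori `B5.Prop12Printed`) and
  **`opClose_dkLoc_allTori`** (the same, HYPOTHESIS-FREE via p19's `prop12Printed_allTori`).
HONEST SCOPE.  (i) Operator form with the `η^d`-weighted action (reading of `BIJ88OpDecay213DkLocTorus`), value member only (no output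
derivative, no `∂*ε*δΠ` dressing: row C2.Eq5.4.7 is r16's).  (ii) Smallness `e^{−cρ_k}` for positive schedules non-increasing in `j < k`
(the printed `r(e_j)`; monotonicity displayed as a hypothesis, as in r18's file).  (iii) `U = 1`, real abelian fields, torus, standing range;
distances as in the cited files.  (iv) No `def`, no new named fact, nothing restated; NOT summit progress.  Unit `lit-balaban-p08`
(literature-prover-lit-balaban-p08-g9-0), 2026-08-21.
-/

open scoped BigOperators RealInnerProductSpace

namespace Literature.MathematicalPhysics.QuantumFieldTheory.BalabanImbrieJaffe1984to88.BIJ88OpCloseDkLocTorus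

open Balaban1983to89 hiding Site Plaq
open Balaban1983to89.LatticeFieldCalculus
open BIJ88Ineq217Ineq722Torus (ofLp_HkE_single exists_bound_of_ineq722 torusKernelData_gradH_nonneg)
open BIJ85AxialPropagator411 (toE)
open BIJ85Prop521Torus BIJ85Prop522Torus BIJ85Sigma422Eta
open BIJ85Sect7Statements BIJ85Ineq722Torus
open BIJ85Ineq722DeltaA (deltaAData ineq722_deltaA_of_prop12Printed)
open BIJ85Ineq722ProofPart2 (settingOf)
open BIJ88ClocFactorsTorus (Cmat distB distB_apply)
open BIJ88ClocEstimatesTorus (Cloc cloc_estimates)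
open BIJ88Sect2Statements (applyK supNorm suppDist OpClose231)
open BIJ88Close235Proof (supNorm_nonneg)
open BIJ85Sect72AllTori (exists_absH_le_allTori_of_prop12Printed abs_H_zero_le)
open BIJ85Prop12PerTower (prop12Printed_levStd_deltaA)
open BIJ85Prop12AllTori (prop12Printed_allTori)
open BIJ88CurlyDkLocTorus BIJ88CurlyDkLocDecayTorus BIJ88OpDecay213DkLocTorus
open BIJ88OpDecay213DkLocGradTorus (weighted_rowsum_triple_le₂)
open BIJ88CurlyDkLocCloseTorus (dk_sub_dkLoc_eq_sum abs_hKer_sub_hlKer_le abs_cKer_sub_clKer_ambient_le cSide_of_cloc_estimates)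
-- inside this namespace the bare `Site`/`Plaq` are the `ℤ^d` carriers of the QFT root; the torus ones are renamed:
open Balaban1983to89 renaming Site → TSite, Plaq → TPlaq

noncomputable section

variable {P : Params}

/-! ## §1  Weighted row sums of the difference, scale by scale -/

/-- `0 < L^n`. [folklore] -/
private theorem cast_pow_L_pos' (n : ℕ) : (0 : ℝ) < (P.L : ℝ) ^ n := pow_pos P.cast_L_pos n

/-- the telescoping `hch′ − h_lc_lh′_l = (h − h_l)ch′ + h_l(c − c_l)h′ + h_lc_l(h′ − h′_l)`. [folklore] -/
private theorem telescope (h hl c cl h' hl' : ℝ) :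
    h * c * h' - hl * cl * hl' = (h - hl) * c * h' + hl * (c - cl) * h' + hl * cl * (h' - hl') := by ring

/-- `Σ_{j<k}(L^{k−j})^{−2} ≤ 1` (`L ≥ 2`). [folklore] -/
private theorem sum_inv_pow_sq_le_one (k : ℕ) : ∑ j ∈ Finset.range k, (((P.L : ℝ) ^ (k - j)) ^ 2)⁻¹ ≤ 1 := by
  have hL : (2 : ℝ) ≤ P.L := by exact_mod_cast P.hL.2
  have hmain : ∀ k : ℕ, ∑ j ∈ Finset.range k, ((P.L : ℝ) ^ (k - j))⁻¹ ≤ 1 := by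
    intro k
    induction k with
    | zero => simp
    | succ k ih =>
      have e : ∑ j ∈ Finset.range (k + 1), ((P.L : ℝ) ^ (k + 1 - j))⁻¹ =
          (P.L : ℝ)⁻¹ * (∑ j ∈ Finset.range k, ((P.L : ℝ) ^ (k - j))⁻¹ + 1) := by
        rw [Finset.sum_range_succ, show k + 1 - k = 1 by omega, pow_one, mul_add, mul_one, Finset.mul_sum]
        refine congrArg (· + _) (Finset.sum_congr rfl fun j hj => ?_)
        rw [show k + 1 - j = (k - j) + 1 by have := Finset.mem_range.1 hj; omega, pow_succ, mul_inv, mul_comm]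
      rw [e]
      calc (P.L : ℝ)⁻¹ * (∑ j ∈ Finset.range k, ((P.L : ℝ) ^ (k - j))⁻¹ + 1) ≤ 2⁻¹ * (1 + 1) :=
            mul_le_mul ((inv_le_inv₀ (by linarith) two_pos).2 hL) (by linarith) (by positivity) (by norm_num)
        _ = 1 := by norm_num
  refine le_trans (Finset.sum_le_sum fun j _ => ?_) (hmain k)
  have hℓ1 : (1 : ℝ) ≤ (P.L : ℝ) ^ (k - j) := one_le_pow₀ (by linarith)
  have hℓ0 : (0 : ℝ) < (P.L : ℝ) ^ (k - j) := by linarith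
  rw [inv_le_inv₀ (by positivity) hℓ0]
  nlinarith

/-- **THE SCALE-`j` DIFFERENCE TERM, `η^d`-WEIGHTED ROW SUM** (`j ≤ k`, `j ≤ m + K`, every `d ≥ 2`, radius `r > 0`): given the sup member of
(I.7.2.2) for `H_j` (`M, δ`) and bounds `M_Ce^{−δ_C|·|}` for p09's `C^{(j)}`, `C^{(j)}_{loc}` (radius `r/4`) and `M_Ce^{−(δ_C/4)r}e^{−δ_C|·|}` for their
difference, `Σ_{b″} η_k^d|Σ_{b₁b₂}[H_jC^{(j),L^jη}H_j − H_{j,loc}C^{(j),L^jη}_{loc}H_{j,loc}](b,b″)|·e^{a·dist_k(b″,b)} ≤ (2e^{−(δ/2)(r/16)} + e^{−(δ_C/4)r})·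
M²M_C·d³e^{a/2}K(a)³·(L^{k−j})^{−2}`, `a = min(δ/2,δ_C)/2` — the three telescoped products, each by `weighted_rowsum_triple_le₂`, and
`η_k^d(L^{k−j})^{d−2}(L^j)^d = (L^{k−j})^{−2}`. [cite: BalabanImbrieJaffe1988, (2.13) p.261] -/
theorem weighted_rowsum_diffTerm_le (hd : 2 ≤ P.d) {k j : ℕ} (hj : j ≤ P.m + P.K) (hjk : j ≤ k) {a : ℝ} (ha : 0 < a)
    {δ M δC MC : ℝ} (hδ : 0 < δ) (hδC : 0 < δC) (hM : 0 ≤ M) (hMC : 0 ≤ MC)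
    (hH : ∀ (μ ν : Fin P.d) (x : TSite P 0) (y : TSite P j),
      |(torusRep P j (deltaAData hj a)).H (x, μ) (y, ν)| ≤ M * Real.exp (-(δ * distEU P j x y)))
    {r : ℝ} (hr : 0 < r)
    (hCm : ∀ b₁ b₂ : PBond P j, |Cmat P j b₁ b₂| ≤ MC * Real.exp (-(δC * (supDist b₁.src b₂.src : ℝ))))
    (hCl : ∀ b₁ b₂ : PBond P j, |Cloc P j (r / 4) b₁ b₂| ≤ MC * Real.exp (-(δC * (supDist b₁.src b₂.src : ℝ))))
    (hCd : ∀ b₁ b₂ : PBond P j, |Cloc P j (r / 4) b₁ b₂ - Cmat P j b₁ b₂| ≤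
      MC * Real.exp (-(δC / 4 * r)) * Real.exp (-(δC * (supDist b₁.src b₂.src : ℝ))))
    (b : PBond P 0) :
    ∑ b'' : PBond P 0, (P.eta k) ^ P.d *
        |∑ b₁ : PBond P j, ∑ b₂ : PBond P j,
          (hKer (P := P) ((P.eta k) ^ P.d) ((P.L : ℝ) ^ k) j b b₁ * cKer (P := P) ((P.eta k) ^ P.d) ((P.L : ℝ) ^ k) j b₁ b₂ *
              hKer (P := P) ((P.eta k) ^ P.d) ((P.L : ℝ) ^ k) j b'' b₂ -
            hlKer (P := P) ((P.eta k) ^ P.d) ((P.L : ℝ) ^ k) (r / 16) (r / 8) j b b₁ *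
                clKer (P := P) ((P.eta k) ^ P.d) ((P.L : ℝ) ^ k) (r / 4) j b₁ b₂ *
              hlKer (P := P) ((P.eta k) ^ P.d) ((P.L : ℝ) ^ k) (r / 16) (r / 8) j b'' b₂)| *
        Real.exp (min (δ / 2) δC / 2 * kdist (P := P) k b'' b) ≤
      (2 * Real.exp (-(δ / 2 * (r / 16))) + Real.exp (-(δC / 4 * r))) *
        (M ^ 2 * MC * (P.d : ℝ) ^ 3 * (Real.exp (min (δ / 2) δC / 2 / 2) * ((2 * (1 + P.d / (min (δ / 2) δC / 2))) ^ P.d) ^ 3)) *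
        (((P.L : ℝ) ^ (k - j)) ^ 2)⁻¹ := by
  have hδ2 : 0 < δ / 2 := half_pos hδ
  have hR : r / 16 < r / 8 := by linarith
  have hw : 0 < (P.eta k) ^ P.d := pow_pos (eta_pos P k) _
  have hc : (P.L : ℝ) ^ k ≠ 0 := (cast_pow_L_pos' k).ne'
  set ℓ : ℝ := (P.L : ℝ) ^ (k - j) with hℓ
  have hℓq : 0 < ℓ ^ (P.d - 2) := pow_pos (cast_pow_L_pos' _) _
  -- the H-side bounds at rate `δ/2`
  have weaken : ∀ (x : TSite P 0) (y : TSite P j),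
      M * Real.exp (-(δ * distEU P j x y)) ≤ M * Real.exp (-(δ / 2 * distEU P j x y)) := by
    intro x y
    refine mul_le_mul_of_nonneg_left (Real.exp_le_exp.2 ?_) hM
    have h0 : 0 ≤ distEU P j x y := div_nonneg (Nat.cast_nonneg _) (cast_pow_L_pos' j).le
    nlinarith
  have hh : ∀ (b₀ : PBond P 0) (b₁ : PBond P j),
      |hKer (P := P) ((P.eta k) ^ P.d) ((P.L : ℝ) ^ k) j b₀ b₁| ≤ M * Real.exp (-(δ / 2 * distEU P j b₀.src b₁.src)) := by
    intro b₀ b₁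
    have e : hKer (P := P) ((P.eta k) ^ P.d) ((P.L : ℝ) ^ k) j b₀ b₁ =
        (torusRep P j (deltaAData hj a)).H (b₀.src, b₀.dir) (b₁.src, b₁.dir) := ofLp_HkE_single hj hc hw ha b₁ b₀.src b₀.dir
    rw [e]
    exact (hH _ _ _ _).trans (weaken _ _)
  have hhl : ∀ (b₀ : PBond P 0) (b₁ : PBond P j),
      |hlKer (P := P) ((P.eta k) ^ P.d) ((P.L : ℝ) ^ k) (r / 16) (r / 8) j b₀ b₁| ≤
        M * Real.exp (-(δ / 2 * distEU P j b₀.src b₁.src)) :=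
    fun b₀ b₁ => (abs_hlKer_le_of_sup hj hw hc ha hH (r / 16) (r / 8) b₀ b₁).trans (weaken _ _)
  have hhd : ∀ (b₀ : PBond P 0) (b₁ : PBond P j),
      |(fun (b₀ : PBond P 0) (b₁ : PBond P j) => hKer (P := P) ((P.eta k) ^ P.d) ((P.L : ℝ) ^ k) j b₀ b₁ -
          hlKer (P := P) ((P.eta k) ^ P.d) ((P.L : ℝ) ^ k) (r / 16) (r / 8) j b₀ b₁) b₀ b₁| ≤
        M * Real.exp (-(δ / 2 * (r / 16))) * Real.exp (-(δ / 2 * distEU P j b₀.src b₁.src)) :=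
    fun b₀ b₁ => abs_hKer_sub_hlKer_le hj hw hc ha hδ.le hH hR b₀ b₁
  -- the C-side bounds at the ambient weights
  have hc1 : ∀ b₁ b₂ : PBond P j, |cKer (P := P) ((P.eta k) ^ P.d) ((P.L : ℝ) ^ k) j b₁ b₂| ≤
      MC * ℓ ^ (P.d - 2) * Real.exp (-(δC * (supDist b₁.src b₂.src : ℝ))) := by
    intro b₁ b₂
    rw [cKer_ambient_eq hd hjk, abs_mul, abs_of_pos hℓq]
    calc ℓ ^ (P.d - 2) * |Cmat P j b₁ b₂| ≤ ℓ ^ (P.d - 2) * (MC * Real.exp (-(δC * (supDist b₁.src b₂.src : ℝ)))) :=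
        mul_le_mul_of_nonneg_left (hCm b₁ b₂) hℓq.le
      _ = _ := by ring
  have hc2 : ∀ b₁ b₂ : PBond P j, |clKer (P := P) ((P.eta k) ^ P.d) ((P.L : ℝ) ^ k) (r / 4) j b₁ b₂| ≤
      MC * ℓ ^ (P.d - 2) * Real.exp (-(δC * (supDist b₁.src b₂.src : ℝ))) := fun b₁ b₂ => abs_clKer_ambient_le hd hjk hCl b₁ b₂
  have hc3 : ∀ b₁ b₂ : PBond P j,
      |(fun b₁ b₂ : PBond P j => cKer (P := P) ((P.eta k) ^ P.d) ((P.L : ℝ) ^ k) j b₁ b₂ -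
          clKer (P := P) ((P.eta k) ^ P.d) ((P.L : ℝ) ^ k) (r / 4) j b₁ b₂) b₁ b₂| ≤
        (ℓ ^ (P.d - 2) * MC * Real.exp (-(δC / 4 * r))) * Real.exp (-(δC * (supDist b₁.src b₂.src : ℝ))) := by
    intro b₁ b₂
    have h := abs_cKer_sub_clKer_ambient_le hd hjk (δC := δC) (ε := MC * Real.exp (-(δC / 4 * r))) (R := r / 4)
      (fun b₁ b₂ => (hCd b₁ b₂).trans (le_of_eq (by ring))) b₁ b₂
    refine h.trans (le_of_eq ?_)
    rw [hℓ]; ring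
  -- the three telescoped products, weighted row sums
  have hM' : 0 ≤ M * Real.exp (-(δ / 2 * (r / 16))) := by positivity
  have hMC1 : 0 ≤ MC * ℓ ^ (P.d - 2) := by positivity
  have hMC3 : 0 ≤ ℓ ^ (P.d - 2) * MC * Real.exp (-(δC / 4 * r)) := by positivity
  have t1 := weighted_rowsum_triple_le₂ (k := k) hj hjk hδ2 hδC hM' hM hMC1 hhd hh hc1 b
  have t2 := weighted_rowsum_triple_le₂ (k := k) hj hjk hδ2 hδC hM hM hMC3 hhl hh hc3 b
  have t3 := weighted_rowsum_triple_le₂ (k := k) hj hjk hδ2 hδC hM hM' hMC1 hhl hhd hc2 b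
  -- split the scale term into the three products, pointwise in `b″`
  have hsplit : ∀ b'' : PBond P 0, (∑ b₁ : PBond P j, ∑ b₂ : PBond P j,
        (hKer (P := P) ((P.eta k) ^ P.d) ((P.L : ℝ) ^ k) j b b₁ * cKer (P := P) ((P.eta k) ^ P.d) ((P.L : ℝ) ^ k) j b₁ b₂ *
            hKer (P := P) ((P.eta k) ^ P.d) ((P.L : ℝ) ^ k) j b'' b₂ -
          hlKer (P := P) ((P.eta k) ^ P.d) ((P.L : ℝ) ^ k) (r / 16) (r / 8) j b b₁ *
              clKer (P := P) ((P.eta k) ^ P.d) ((P.L : ℝ) ^ k) (r / 4) j b₁ b₂ *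
            hlKer (P := P) ((P.eta k) ^ P.d) ((P.L : ℝ) ^ k) (r / 16) (r / 8) j b'' b₂)) =
      (∑ b₁ : PBond P j, ∑ b₂ : PBond P j,
        (fun (b₀ : PBond P 0) (b₁ : PBond P j) => hKer (P := P) ((P.eta k) ^ P.d) ((P.L : ℝ) ^ k) j b₀ b₁ -
            hlKer (P := P) ((P.eta k) ^ P.d) ((P.L : ℝ) ^ k) (r / 16) (r / 8) j b₀ b₁) b b₁ *
          cKer (P := P) ((P.eta k) ^ P.d) ((P.L : ℝ) ^ k) j b₁ b₂ * hKer (P := P) ((P.eta k) ^ P.d) ((P.L : ℝ) ^ k) j b'' b₂) +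
      (∑ b₁ : PBond P j, ∑ b₂ : PBond P j,
        hlKer (P := P) ((P.eta k) ^ P.d) ((P.L : ℝ) ^ k) (r / 16) (r / 8) j b b₁ *
          (fun b₁ b₂ : PBond P j => cKer (P := P) ((P.eta k) ^ P.d) ((P.L : ℝ) ^ k) j b₁ b₂ -
            clKer (P := P) ((P.eta k) ^ P.d) ((P.L : ℝ) ^ k) (r / 4) j b₁ b₂) b₁ b₂ *
          hKer (P := P) ((P.eta k) ^ P.d) ((P.L : ℝ) ^ k) j b'' b₂) +
      (∑ b₁ : PBond P j, ∑ b₂ : PBond P j,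
        hlKer (P := P) ((P.eta k) ^ P.d) ((P.L : ℝ) ^ k) (r / 16) (r / 8) j b b₁ *
          clKer (P := P) ((P.eta k) ^ P.d) ((P.L : ℝ) ^ k) (r / 4) j b₁ b₂ *
          (fun (b₀ : PBond P 0) (b₁ : PBond P j) => hKer (P := P) ((P.eta k) ^ P.d) ((P.L : ℝ) ^ k) j b₀ b₁ -
            hlKer (P := P) ((P.eta k) ^ P.d) ((P.L : ℝ) ^ k) (r / 16) (r / 8) j b₀ b₁) b'' b₂) := by
    intro b''
    rw [← Finset.sum_add_distrib, ← Finset.sum_add_distrib]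
    refine Finset.sum_congr rfl fun b₁ _ => ?_
    rw [← Finset.sum_add_distrib, ← Finset.sum_add_distrib]
    refine Finset.sum_congr rfl fun b₂ _ => ?_
    exact telescope _ _ _ _ _ _
  have hscal : (P.eta k) ^ P.d * (ℓ ^ (P.d - 2) * ((P.L : ℝ) ^ j) ^ P.d) = (ℓ ^ 2)⁻¹ := by
    rw [← mul_assoc, hℓ]; exact eta_pow_scaling hd hjk
  -- pointwise split of the summand, then the three row sums
  calc ∑ b'' : PBond P 0, (P.eta k) ^ P.d * |_| * Real.exp (min (δ / 2) δC / 2 * kdist (P := P) k b'' b)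
      ≤ ∑ b'' : PBond P 0, (P.eta k) ^ P.d * ((|∑ b₁ : PBond P j, ∑ b₂ : PBond P j,
            (fun (b₀ : PBond P 0) (b₁ : PBond P j) => hKer (P := P) ((P.eta k) ^ P.d) ((P.L : ℝ) ^ k) j b₀ b₁ -
                hlKer (P := P) ((P.eta k) ^ P.d) ((P.L : ℝ) ^ k) (r / 16) (r / 8) j b₀ b₁) b b₁ *
              cKer (P := P) ((P.eta k) ^ P.d) ((P.L : ℝ) ^ k) j b₁ b₂ * hKer (P := P) ((P.eta k) ^ P.d) ((P.L : ℝ) ^ k) j b'' b₂| *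
            Real.exp (min (δ / 2) δC / 2 * kdist (P := P) k b'' b) +
          |∑ b₁ : PBond P j, ∑ b₂ : PBond P j,
            hlKer (P := P) ((P.eta k) ^ P.d) ((P.L : ℝ) ^ k) (r / 16) (r / 8) j b b₁ *
              (fun b₁ b₂ : PBond P j => cKer (P := P) ((P.eta k) ^ P.d) ((P.L : ℝ) ^ k) j b₁ b₂ -
                clKer (P := P) ((P.eta k) ^ P.d) ((P.L : ℝ) ^ k) (r / 4) j b₁ b₂) b₁ b₂ *
              hKer (P := P) ((P.eta k) ^ P.d) ((P.L : ℝ) ^ k) j b'' b₂| *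
            Real.exp (min (δ / 2) δC / 2 * kdist (P := P) k b'' b)) +
          |∑ b₁ : PBond P j, ∑ b₂ : PBond P j,
            hlKer (P := P) ((P.eta k) ^ P.d) ((P.L : ℝ) ^ k) (r / 16) (r / 8) j b b₁ *
              clKer (P := P) ((P.eta k) ^ P.d) ((P.L : ℝ) ^ k) (r / 4) j b₁ b₂ *
              (fun (b₀ : PBond P 0) (b₁ : PBond P j) => hKer (P := P) ((P.eta k) ^ P.d) ((P.L : ℝ) ^ k) j b₀ b₁ -
                hlKer (P := P) ((P.eta k) ^ P.d) ((P.L : ℝ) ^ k) (r / 16) (r / 8) j b₀ b₁) b'' b₂| *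
            Real.exp (min (δ / 2) δC / 2 * kdist (P := P) k b'' b)) := by
        refine Finset.sum_le_sum fun b'' _ => ?_
        rw [hsplit b'', mul_assoc]
        refine mul_le_mul_of_nonneg_left ?_ hw.le
        have hE := (Real.exp_pos (min (δ / 2) δC / 2 * kdist (P := P) k b'' b)).le
        nlinarith [abs_add_three
          (∑ b₁ : PBond P j, ∑ b₂ : PBond P j,
            (fun (b₀ : PBond P 0) (b₁ : PBond P j) => hKer (P := P) ((P.eta k) ^ P.d) ((P.L : ℝ) ^ k) j b₀ b₁ -
                hlKer (P := P) ((P.eta k) ^ P.d) ((P.L : ℝ) ^ k) (r / 16) (r / 8) j b₀ b₁) b b₁ *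
              cKer (P := P) ((P.eta k) ^ P.d) ((P.L : ℝ) ^ k) j b₁ b₂ * hKer (P := P) ((P.eta k) ^ P.d) ((P.L : ℝ) ^ k) j b'' b₂)
          (∑ b₁ : PBond P j, ∑ b₂ : PBond P j,
            hlKer (P := P) ((P.eta k) ^ P.d) ((P.L : ℝ) ^ k) (r / 16) (r / 8) j b b₁ *
              (fun b₁ b₂ : PBond P j => cKer (P := P) ((P.eta k) ^ P.d) ((P.L : ℝ) ^ k) j b₁ b₂ -
                clKer (P := P) ((P.eta k) ^ P.d) ((P.L : ℝ) ^ k) (r / 4) j b₁ b₂) b₁ b₂ *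
              hKer (P := P) ((P.eta k) ^ P.d) ((P.L : ℝ) ^ k) j b'' b₂)
          (∑ b₁ : PBond P j, ∑ b₂ : PBond P j,
            hlKer (P := P) ((P.eta k) ^ P.d) ((P.L : ℝ) ^ k) (r / 16) (r / 8) j b b₁ *
              clKer (P := P) ((P.eta k) ^ P.d) ((P.L : ℝ) ^ k) (r / 4) j b₁ b₂ *
              (fun (b₀ : PBond P 0) (b₁ : PBond P j) => hKer (P := P) ((P.eta k) ^ P.d) ((P.L : ℝ) ^ k) j b₀ b₁ -
                hlKer (P := P) ((P.eta k) ^ P.d) ((P.L : ℝ) ^ k) (r / 16) (r / 8) j b₀ b₁) b'' b₂)]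
    _ = (P.eta k) ^ P.d * ((∑ b'' : PBond P 0, |∑ b₁ : PBond P j, ∑ b₂ : PBond P j,
            (fun (b₀ : PBond P 0) (b₁ : PBond P j) => hKer (P := P) ((P.eta k) ^ P.d) ((P.L : ℝ) ^ k) j b₀ b₁ -
                hlKer (P := P) ((P.eta k) ^ P.d) ((P.L : ℝ) ^ k) (r / 16) (r / 8) j b₀ b₁) b b₁ *
              cKer (P := P) ((P.eta k) ^ P.d) ((P.L : ℝ) ^ k) j b₁ b₂ * hKer (P := P) ((P.eta k) ^ P.d) ((P.L : ℝ) ^ k) j b'' b₂| *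
            Real.exp (min (δ / 2) δC / 2 * kdist (P := P) k b'' b) +
          ∑ b'' : PBond P 0, |∑ b₁ : PBond P j, ∑ b₂ : PBond P j,
            hlKer (P := P) ((P.eta k) ^ P.d) ((P.L : ℝ) ^ k) (r / 16) (r / 8) j b b₁ *
              (fun b₁ b₂ : PBond P j => cKer (P := P) ((P.eta k) ^ P.d) ((P.L : ℝ) ^ k) j b₁ b₂ -
                clKer (P := P) ((P.eta k) ^ P.d) ((P.L : ℝ) ^ k) (r / 4) j b₁ b₂) b₁ b₂ *
              hKer (P := P) ((P.eta k) ^ P.d) ((P.L : ℝ) ^ k) j b'' b₂| *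
            Real.exp (min (δ / 2) δC / 2 * kdist (P := P) k b'' b)) +
          ∑ b'' : PBond P 0, |∑ b₁ : PBond P j, ∑ b₂ : PBond P j,
            hlKer (P := P) ((P.eta k) ^ P.d) ((P.L : ℝ) ^ k) (r / 16) (r / 8) j b b₁ *
              clKer (P := P) ((P.eta k) ^ P.d) ((P.L : ℝ) ^ k) (r / 4) j b₁ b₂ *
              (fun (b₀ : PBond P 0) (b₁ : PBond P j) => hKer (P := P) ((P.eta k) ^ P.d) ((P.L : ℝ) ^ k) j b₀ b₁ -
                hlKer (P := P) ((P.eta k) ^ P.d) ((P.L : ℝ) ^ k) (r / 16) (r / 8) j b₀ b₁) b'' b₂| *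
            Real.exp (min (δ / 2) δC / 2 * kdist (P := P) k b'' b)) := by
        rw [← Finset.mul_sum, Finset.sum_add_distrib, Finset.sum_add_distrib]
    _ ≤ (P.eta k) ^ P.d * ((M * Real.exp (-(δ / 2 * (r / 16))) * M * (MC * ℓ ^ (P.d - 2)) * (P.d : ℝ) ^ 3 *
            (Real.exp (min (δ / 2) δC / 2 / 2) * ((2 * (1 + P.d / (min (δ / 2) δC / 2))) ^ P.d) ^ 3) * ((P.L : ℝ) ^ j) ^ P.d +
          M * M * (ℓ ^ (P.d - 2) * MC * Real.exp (-(δC / 4 * r))) * (P.d : ℝ) ^ 3 *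
            (Real.exp (min (δ / 2) δC / 2 / 2) * ((2 * (1 + P.d / (min (δ / 2) δC / 2))) ^ P.d) ^ 3) * ((P.L : ℝ) ^ j) ^ P.d) +
          M * (M * Real.exp (-(δ / 2 * (r / 16)))) * (MC * ℓ ^ (P.d - 2)) * (P.d : ℝ) ^ 3 *
            (Real.exp (min (δ / 2) δC / 2 / 2) * ((2 * (1 + P.d / (min (δ / 2) δC / 2))) ^ P.d) ^ 3) * ((P.L : ℝ) ^ j) ^ P.d) :=
        mul_le_mul_of_nonneg_left (add_le_add (add_le_add t1 t2) t3) hw.le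
    _ = (2 * Real.exp (-(δ / 2 * (r / 16))) + Real.exp (-(δC / 4 * r))) *
          (M ^ 2 * MC * (P.d : ℝ) ^ 3 * (Real.exp (min (δ / 2) δC / 2 / 2) * ((2 * (1 + P.d / (min (δ / 2) δC / 2))) ^ P.d) ^ 3)) *
          ((P.eta k) ^ P.d * (ℓ ^ (P.d - 2) * ((P.L : ℝ) ^ j) ^ P.d)) := by ring
    _ = _ := by rw [hscal]

/-- **THE `η`-LATTICE ROW SUMS OF `𝒟_k − 𝒟_{k,loc}` AGAINST THE EXPONENTIAL WEIGHT ARE `≲ e^{−cρ_k}`, uniformly in `k ≤ m + K`**: for a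
positive schedule with `ρ_k ≤ ρ_j` (`j < k`), `Σ_{b″} η_k^d|𝒟_k(b,b″) − 𝒟_{k,loc}(b,b″)|e^{a·dist_k(b″,b)} ≤ 3M²M_C·d³e^{a/2}K(a)³·e^{−cρ_k}`,
`a = min(δ/2,δ_C)/2`, `c = min(δ/32,δ_C/4)` — the scale terms `≲ (L^{k−j})^{−2}` are summable with no threshold.
[cite: BalabanImbrieJaffe1988, (2.13) p.261] -/
theorem weighted_rowsum_dkSubDkLoc_le (hd : 2 ≤ P.d) {k : ℕ} (hk : k ≤ P.m + P.K) {a : ℝ} (ha : 0 < a) {δ M δC MC : ℝ}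
    (hδ : 0 < δ) (hδC : 0 < δC) (hM : 0 ≤ M) (hMC : 0 ≤ MC)
    (hH : ∀ (j : ℕ) (hj : j ≤ P.m + P.K), j < k → ∀ (μ ν : Fin P.d) (x : TSite P 0) (y : TSite P j),
      |(torusRep P j (deltaAData hj a)).H (x, μ) (y, ν)| ≤ M * Real.exp (-(δ * distEU P j x y)))
    (ρ : ℕ → ℝ) (hρ : ∀ j < k, 0 < ρ j) (hmono : ∀ j < k, ρ k ≤ ρ j)
    (hCm : ∀ j < k, ∀ b₁ b₂ : PBond P j, |Cmat P j b₁ b₂| ≤ MC * Real.exp (-(δC * (supDist b₁.src b₂.src : ℝ))))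
    (hCl : ∀ j < k, ∀ b₁ b₂ : PBond P j, |Cloc P j (ρ j / 4) b₁ b₂| ≤ MC * Real.exp (-(δC * (supDist b₁.src b₂.src : ℝ))))
    (hCd : ∀ j < k, ∀ b₁ b₂ : PBond P j, |Cloc P j (ρ j / 4) b₁ b₂ - Cmat P j b₁ b₂| ≤
      MC * Real.exp (-(δC / 4 * ρ j)) * Real.exp (-(δC * (supDist b₁.src b₂.src : ℝ))))
    (b : PBond P 0) :
    ∑ b'' : PBond P 0, (P.eta k) ^ P.d *
        |DkE P ((P.eta k) ^ P.d) ((P.L : ℝ) ^ k) k (toE P (Pi.single b'' 1)) b -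
          dkLocKer (P := P) ((P.eta k) ^ P.d) ((P.L : ℝ) ^ k) ρ k b b''| *
        Real.exp (min (δ / 2) δC / 2 * kdist (P := P) k b'' b) ≤
      3 * (M ^ 2 * MC * (P.d : ℝ) ^ 3 * (Real.exp (min (δ / 2) δC / 2 / 2) * ((2 * (1 + P.d / (min (δ / 2) δC / 2))) ^ P.d) ^ 3)) *
        Real.exp (-(min (δ / 32) (δC / 4) * ρ k)) := by
  have hw : 0 ≤ (P.eta k) ^ P.d := (pow_pos (eta_pos P k) _).le
  set S : ℝ := M ^ 2 * MC * (P.d : ℝ) ^ 3 * (Real.exp (min (δ / 2) δC / 2 / 2) * ((2 * (1 + P.d / (min (δ / 2) δC / 2))) ^ P.d) ^ 3)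
    with hS
  have hS0 : 0 ≤ S := by positivity
  have hcc1 : min (δ / 32) (δC / 4) ≤ δ / 32 := min_le_left _ _
  have hcc2 : min (δ / 32) (δC / 4) ≤ δC / 4 := min_le_right _ _
  -- the smallness factors of the scales are at most `3e^{−cρ_k}`
  have hsmall : ∀ j < k, 2 * Real.exp (-(δ / 2 * (ρ j / 16))) + Real.exp (-(δC / 4 * ρ j)) ≤
      3 * Real.exp (-(min (δ / 32) (δC / 4) * ρ k)) := by
    intro j hjk
    have hρj : 0 < ρ j := hρ j hjk
    have hkj : ρ k ≤ ρ j := hmono j hjk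
    have e1 : Real.exp (-(δ / 2 * (ρ j / 16))) ≤ Real.exp (-(min (δ / 32) (δC / 4) * ρ k)) := by
      refine Real.exp_le_exp.2 ?_
      have : min (δ / 32) (δC / 4) * ρ k ≤ δ / 32 * ρ j :=
        (mul_le_mul_of_nonneg_left hkj (le_min (by positivity) (by positivity))).trans
          (mul_le_mul_of_nonneg_right hcc1 hρj.le)
      linarith
    have e2 : Real.exp (-(δC / 4 * ρ j)) ≤ Real.exp (-(min (δ / 32) (δC / 4) * ρ k)) := by
      refine Real.exp_le_exp.2 ?_
      have : min (δ / 32) (δC / 4) * ρ k ≤ δC / 4 * ρ j :=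
        (mul_le_mul_of_nonneg_left hkj (le_min (by positivity) (by positivity))).trans
          (mul_le_mul_of_nonneg_right hcc2 hρj.le)
      linarith
    linarith
  have hterm : ∀ j ∈ Finset.range k, ∑ b'' : PBond P 0, (P.eta k) ^ P.d *
      |∑ b₁ : PBond P j, ∑ b₂ : PBond P j,
          (hKer (P := P) ((P.eta k) ^ P.d) ((P.L : ℝ) ^ k) j b b₁ * cKer (P := P) ((P.eta k) ^ P.d) ((P.L : ℝ) ^ k) j b₁ b₂ *
              hKer (P := P) ((P.eta k) ^ P.d) ((P.L : ℝ) ^ k) j b'' b₂ -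
            hlKer (P := P) ((P.eta k) ^ P.d) ((P.L : ℝ) ^ k) (ρ j / 16) (ρ j / 8) j b b₁ *
                clKer (P := P) ((P.eta k) ^ P.d) ((P.L : ℝ) ^ k) (ρ j / 4) j b₁ b₂ *
              hlKer (P := P) ((P.eta k) ^ P.d) ((P.L : ℝ) ^ k) (ρ j / 16) (ρ j / 8) j b'' b₂)| *
        Real.exp (min (δ / 2) δC / 2 * kdist (P := P) k b'' b) ≤
      3 * S * Real.exp (-(min (δ / 32) (δC / 4) * ρ k)) * (((P.L : ℝ) ^ (k - j)) ^ 2)⁻¹ := by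
    intro j hjm
    have hjk : j < k := Finset.mem_range.1 hjm
    have hj : j ≤ P.m + P.K := by omega
    refine (weighted_rowsum_diffTerm_le hd hj hjk.le ha hδ hδC hM hMC (hH j hj hjk) (hρ j hjk) (hCm j hjk) (hCl j hjk)
      (hCd j hjk) b).trans ?_
    refine mul_le_mul_of_nonneg_right ?_ (inv_pos.2 (pow_pos (cast_pow_L_pos' _) 2)).le
    calc (2 * Real.exp (-(δ / 2 * (ρ j / 16))) + Real.exp (-(δC / 4 * ρ j))) * S
        ≤ (3 * Real.exp (-(min (δ / 32) (δC / 4) * ρ k))) * S := mul_le_mul_of_nonneg_right (hsmall j hjk) hS0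
      _ = 3 * S * Real.exp (-(min (δ / 32) (δC / 4) * ρ k)) := by ring
  calc ∑ b'' : PBond P 0, (P.eta k) ^ P.d *
          |DkE P ((P.eta k) ^ P.d) ((P.L : ℝ) ^ k) k (toE P (Pi.single b'' 1)) b -
            dkLocKer (P := P) ((P.eta k) ^ P.d) ((P.L : ℝ) ^ k) ρ k b b''| * Real.exp (min (δ / 2) δC / 2 * kdist (P := P) k b'' b)
      ≤ ∑ b'' : PBond P 0, ∑ j ∈ Finset.range k, (P.eta k) ^ P.d *
          |∑ b₁ : PBond P j, ∑ b₂ : PBond P j,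
            (hKer (P := P) ((P.eta k) ^ P.d) ((P.L : ℝ) ^ k) j b b₁ * cKer (P := P) ((P.eta k) ^ P.d) ((P.L : ℝ) ^ k) j b₁ b₂ *
                hKer (P := P) ((P.eta k) ^ P.d) ((P.L : ℝ) ^ k) j b'' b₂ -
              hlKer (P := P) ((P.eta k) ^ P.d) ((P.L : ℝ) ^ k) (ρ j / 16) (ρ j / 8) j b b₁ *
                  clKer (P := P) ((P.eta k) ^ P.d) ((P.L : ℝ) ^ k) (ρ j / 4) j b₁ b₂ *
                hlKer (P := P) ((P.eta k) ^ P.d) ((P.L : ℝ) ^ k) (ρ j / 16) (ρ j / 8) j b'' b₂)| *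
          Real.exp (min (δ / 2) δC / 2 * kdist (P := P) k b'' b) := by
        refine Finset.sum_le_sum fun b'' _ => ?_
        rw [dk_sub_dkLoc_eq_sum, ← Finset.sum_mul, ← Finset.mul_sum]
        exact mul_le_mul_of_nonneg_right (mul_le_mul_of_nonneg_left (Finset.abs_sum_le_sum_abs _ _) hw) (Real.exp_pos _).le
    _ = ∑ j ∈ Finset.range k, ∑ b'' : PBond P 0, (P.eta k) ^ P.d *
          |∑ b₁ : PBond P j, ∑ b₂ : PBond P j,
            (hKer (P := P) ((P.eta k) ^ P.d) ((P.L : ℝ) ^ k) j b b₁ * cKer (P := P) ((P.eta k) ^ P.d) ((P.L : ℝ) ^ k) j b₁ b₂ *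
                hKer (P := P) ((P.eta k) ^ P.d) ((P.L : ℝ) ^ k) j b'' b₂ -
              hlKer (P := P) ((P.eta k) ^ P.d) ((P.L : ℝ) ^ k) (ρ j / 16) (ρ j / 8) j b b₁ *
                  clKer (P := P) ((P.eta k) ^ P.d) ((P.L : ℝ) ^ k) (ρ j / 4) j b₁ b₂ *
                hlKer (P := P) ((P.eta k) ^ P.d) ((P.L : ℝ) ^ k) (ρ j / 16) (ρ j / 8) j b'' b₂)| *
          Real.exp (min (δ / 2) δC / 2 * kdist (P := P) k b'' b) := Finset.sum_comm
    _ ≤ ∑ j ∈ Finset.range k, 3 * S * Real.exp (-(min (δ / 32) (δC / 4) * ρ k)) * (((P.L : ℝ) ^ (k - j)) ^ 2)⁻¹ :=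
        Finset.sum_le_sum hterm
    _ = 3 * S * Real.exp (-(min (δ / 32) (δC / 4) * ρ k)) * ∑ j ∈ Finset.range k, (((P.L : ℝ) ^ (k - j)) ^ 2)⁻¹ := by
        rw [Finset.mul_sum]
    _ ≤ 3 * S * Real.exp (-(min (δ / 32) (δC / 4) * ρ k)) * 1 :=
        mul_le_mul_of_nonneg_left (sum_inv_pow_sq_le_one k) (by positivity)
    _ = _ := by rw [mul_one]

/-! ## §2  The operator form: all `b`, no threshold -/

/-- **`𝒟_{k,loc}` IS CLOSE TO `𝒟_k` IN OPERATOR FORM, EXPLICIT CONSTANTS, ALL `b`** (every `d ≥ 2`): with the `η`-lattice action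
`((𝒟_k − 𝒟_{k,loc})f)(b) = Σ_{b″}η_k^d(𝒟_k(b,b″) − 𝒟_{k,loc}(b,b″))f(b″)`, `|((𝒟_k − 𝒟_{k,loc})f)(b)| ≤ 3M²M_C·d³e^{a/2}K(a)³·e^{−cρ_k}·e^{−a·dist_k(suppt f,b)}‖f‖_∞`,
`a = min(δ/2,δ_C)/2`, `c = min(δ/32,δ_C/4)`, for every `k ≤ m + K`, every positive schedule non-increasing below `k`, every `f` and EVERY `b` —
GIVEN the sup member of (I.7.2.2) for the `H_j` and the three C-side bounds — *"𝒟_{k,loc} is close to 𝒟_k"* in the shape of (2.31).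
[cite: BalabanImbrieJaffe1988, (2.13) p.261] -/
theorem abs_apply_dkSubDkLoc_le (hd : 2 ≤ P.d) {k : ℕ} (hk : k ≤ P.m + P.K) {a : ℝ} (ha : 0 < a) {δ M δC MC : ℝ}
    (hδ : 0 < δ) (hδC : 0 < δC) (hM : 0 ≤ M) (hMC : 0 ≤ MC)
    (hH : ∀ (j : ℕ) (hj : j ≤ P.m + P.K), j < k → ∀ (μ ν : Fin P.d) (x : TSite P 0) (y : TSite P j),
      |(torusRep P j (deltaAData hj a)).H (x, μ) (y, ν)| ≤ M * Real.exp (-(δ * distEU P j x y)))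
    (ρ : ℕ → ℝ) (hρ : ∀ j < k, 0 < ρ j) (hmono : ∀ j < k, ρ k ≤ ρ j)
    (hCm : ∀ j < k, ∀ b₁ b₂ : PBond P j, |Cmat P j b₁ b₂| ≤ MC * Real.exp (-(δC * (supDist b₁.src b₂.src : ℝ))))
    (hCl : ∀ j < k, ∀ b₁ b₂ : PBond P j, |Cloc P j (ρ j / 4) b₁ b₂| ≤ MC * Real.exp (-(δC * (supDist b₁.src b₂.src : ℝ))))
    (hCd : ∀ j < k, ∀ b₁ b₂ : PBond P j, |Cloc P j (ρ j / 4) b₁ b₂ - Cmat P j b₁ b₂| ≤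
      MC * Real.exp (-(δC / 4 * ρ j)) * Real.exp (-(δC * (supDist b₁.src b₂.src : ℝ))))
    (f : PBond P 0 → ℝ) (b : PBond P 0) :
    |applyK (fun b b'' => (P.eta k) ^ P.d * (DkE P ((P.eta k) ^ P.d) ((P.L : ℝ) ^ k) k (toE P (Pi.single b'' 1)) b -
        dkLocKer (P := P) ((P.eta k) ^ P.d) ((P.L : ℝ) ^ k) ρ k b b'')) f b| ≤
      3 * (M ^ 2 * MC * (P.d : ℝ) ^ 3 * (Real.exp (min (δ / 2) δC / 2 / 2) * ((2 * (1 + P.d / (min (δ / 2) δC / 2))) ^ P.d) ^ 3)) *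
        Real.exp (-(min (δ / 32) (δC / 4) * ρ k)) *
        Real.exp (-(min (δ / 2) δC / 2) * suppDist (fun a b => kdist (P := P) k a b) f b) * supNorm f := by
  have ha₀ : 0 ≤ min (δ / 2) δC / 2 := (half_pos (lt_min (half_pos hδ) hδC)).le
  have hw : 0 ≤ (P.eta k) ^ P.d := (pow_pos (eta_pos P k) _).le
  refine abs_applyK_le_of_weighted_rowsum (dist := fun a b => kdist (P := P) k a b) ha₀ ?_ f
  have e : ∀ b'' : PBond P 0, |(P.eta k) ^ P.d * (DkE P ((P.eta k) ^ P.d) ((P.L : ℝ) ^ k) k (toE P (Pi.single b'' 1)) b -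
      dkLocKer (P := P) ((P.eta k) ^ P.d) ((P.L : ℝ) ^ k) ρ k b b'')| = (P.eta k) ^ P.d *
        |DkE P ((P.eta k) ^ P.d) ((P.L : ℝ) ^ k) k (toE P (Pi.single b'' 1)) b -
          dkLocKer (P := P) ((P.eta k) ^ P.d) ((P.L : ℝ) ^ k) ρ k b b''| := by
    intro b''; rw [abs_mul, abs_of_nonneg hw]
  simp only [e]
  exact weighted_rowsum_dkSubDkLoc_le hd hk ha hδ hδC hM hMC hH ρ hρ hmono hCm hCl hCd b

/-- **OPERATOR CLOSENESS ON A TORUS FROM THE TYPED (I.7.2.2)** (r15's `KernelData.Ineq722` for p09's kernel family; C-side HYPOTHESIS-FREE by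
p09's `cloc_estimates` through r18's `cSide_of_cloc_estimates`): `∃ c₀ c δ′, 0 < c ∧ 0 < δ′ ∧ 0 ≤ c₀ ∧ ∀ k ≤ m + K, ∀ ρ` (positive,
non-increasing below `k`), `∀ f b, |((𝒟_k − 𝒟_{k,loc})f)(b)| ≤ c₀e^{−cρ_k}e^{−δ′dist_k(suppt f,b)}‖f‖_∞`. [cite: BalabanImbrieJaffe1988, (2.13) p.261] -/
theorem opClose_dkLoc_of_ineq722 (hd : 2 ≤ P.d) {lev : ℕ → ℕ} (hlev : ∀ i, lev i ≤ P.m + P.K)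
    (hcov : ∀ j ≤ P.m + P.K, ∃ i, lev i = j) {a : ℝ} {BondU : ℕ → Type}
    {distEB : (i : ℕ) → TSite P 0 → BondU i → ℝ} {Cker : (i : ℕ) → Fin P.d → Fin P.d → TSite P (lev i) → TSite P (lev i) → ℝ}
    {Dker : (i : ℕ) → TSite P 0 → BondU i → ℝ}
    (h722 : KernelData.Ineq722
      (fun i => torusKernelData P (lev i) (deltaAData (hlev i) a) (BondU i) (distEB i) (Cker i) (Dker i))) (ha : 0 < a) :
    ∃ c₀ c δ' : ℝ, 0 < c ∧ 0 < δ' ∧ 0 ≤ c₀ ∧ ∀ (k : ℕ) (_ : k ≤ P.m + P.K) (ρ : ℕ → ℝ),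
      (∀ j < k, 0 < ρ j) → (∀ j < k, ρ k ≤ ρ j) → ∀ (f : PBond P 0 → ℝ) (b : PBond P 0),
        |applyK (fun b b'' => (P.eta k) ^ P.d * (DkE P ((P.eta k) ^ P.d) ((P.L : ℝ) ^ k) k (toE P (Pi.single b'' 1)) b -
            dkLocKer (P := P) ((P.eta k) ^ P.d) ((P.L : ℝ) ^ k) ρ k b b'')) f b| ≤
          c₀ * Real.exp (-(c * ρ k)) * Real.exp (-δ' * suppDist (fun a b => kdist (P := P) k a b) f b) * supNorm f := by
  classical
  obtain ⟨δ, M, hδ, hM, hBall⟩ := exists_bound_of_ineq722 hlev h722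
  obtain ⟨MC, δ₀, hMC, hδ₀, HC⟩ := cloc_estimates P.d P.L hd
  have hδC : 0 < δ₀ / 2 := half_pos hδ₀
  refine ⟨3 * (M ^ 2 * (MC * (Real.exp (4 * δ₀ * P.L) * (1 + P.L) ^ 2)) * (P.d : ℝ) ^ 3 *
      (Real.exp (min (δ / 2) (δ₀ / 2) / 2 / 2) * ((2 * (1 + P.d / (min (δ / 2) (δ₀ / 2) / 2))) ^ P.d) ^ 3)),
    min (δ / 32) (δ₀ / 2 / 4), min (δ / 2) (δ₀ / 2) / 2, lt_min (by positivity) (by positivity),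
    half_pos (lt_min (half_pos hδ) hδC), by positivity, fun k hk ρ hρ hmono f b => ?_⟩
  have hH : ∀ (j : ℕ) (hj : j ≤ P.m + P.K), j < k → ∀ (μ ν : Fin P.d) (x : TSite P 0) (y : TSite P j),
      |(torusRep P j (deltaAData hj a)).H (x, μ) (y, ν)| ≤ M * Real.exp (-(δ * distEU P j x y)) := by
    intro j hj _ μ ν x y
    obtain ⟨i, hi⟩ := hcov j hj
    subst hi
    exact (le_add_of_nonneg_right torusKernelData_gradH_nonneg).trans (hBall i μ ν x y)
  have hC : ∀ j < k, (∀ b₁ b₂ : PBond P j, |Cmat P j b₁ b₂| ≤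
        MC * (Real.exp (4 * δ₀ * P.L) * (1 + P.L) ^ 2) * Real.exp (-(δ₀ / 2 * (supDist b₁.src b₂.src : ℝ)))) ∧
      (∀ b₁ b₂ : PBond P j, |Cloc P j (ρ j / 4) b₁ b₂| ≤
        MC * (Real.exp (4 * δ₀ * P.L) * (1 + P.L) ^ 2) * Real.exp (-(δ₀ / 2 * (supDist b₁.src b₂.src : ℝ)))) ∧
      (∀ b₁ b₂ : PBond P j, |Cloc P j (ρ j / 4) b₁ b₂ - Cmat P j b₁ b₂| ≤
        MC * (Real.exp (4 * δ₀ * P.L) * (1 + P.L) ^ 2) * Real.exp (-(δ₀ / 2 / 4 * ρ j)) *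
          Real.exp (-(δ₀ / 2 * (supDist b₁.src b₂.src : ℝ)))) :=
    fun j hjk => cSide_of_cloc_estimates hMC hδ₀ (fun R b b' => HC P rfl rfl j inferInstance (by omega) R b b') (ρ j)
  rw [neg_mul]
  exact (abs_apply_dkSubDkLoc_le hd hk ha hδ hδC hM (by positivity) hH ρ hρ hmono (fun j hjk => (hC j hjk).1)
    (fun j hjk => (hC j hjk).2.1) (fun j hjk => (hC j hjk).2.2) f b).trans (le_of_eq (by ring))

/-- **`𝒟_{k,loc}` IS CLOSE TO `𝒟_k` IN OPERATOR FORM ON EVERY TORUS — NO HYPOTHESIS** (`d ≥ 2`; per-tower [6I] Prop. 1.2 is p16's theorem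
`prop12Printed_levStd_deltaA`, typing note G-C1-07; the objects do not depend on the mass parameter, taken `a = 1`): `∃ c₀ c δ′`, `0 < c`,
`0 < δ′`, `0 ≤ c₀`, `∀ k ≤ m + K ∀ ρ` positive and non-increasing below `k`, `∀ f b`:
`|((𝒟_k − 𝒟_{k,loc})f)(b)| ≤ c₀e^{−cρ_k}e^{−δ′dist_k(suppt f,b)}‖f‖_∞`. [cite: BalabanImbrieJaffe1988, (2.13) p.261] -/
theorem opClose_dkLoc_torus (hd : 2 ≤ P.d) :
    ∃ c₀ c δ' : ℝ, 0 < c ∧ 0 < δ' ∧ 0 ≤ c₀ ∧ ∀ (k : ℕ) (_ : k ≤ P.m + P.K) (ρ : ℕ → ℝ),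
      (∀ j < k, 0 < ρ j) → (∀ j < k, ρ k ≤ ρ j) → ∀ (f : PBond P 0 → ℝ) (b : PBond P 0),
        |applyK (fun b b'' => (P.eta k) ^ P.d * (DkE P ((P.eta k) ^ P.d) ((P.L : ℝ) ^ k) k (toE P (Pi.single b'' 1)) b -
            dkLocKer (P := P) ((P.eta k) ^ P.d) ((P.L : ℝ) ^ k) ρ k b b'')) f b| ≤
          c₀ * Real.exp (-(c * ρ k)) * Real.exp (-δ' * suppDist (fun a b => kdist (P := P) k a b) f b) * supNorm f :=
  opClose_dkLoc_of_ineq722 hd levStd_le (fun j hj => ⟨j, min_eq_left hj⟩)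
    (ineq722_deltaA_of_prop12Printed (levStd P) levStd_le one_pos (fun _ => PUnit) (fun _ _ _ => 0) (fun _ _ _ _ _ => 0)
      (fun _ _ _ => 0) (prop12Printed_levStd_deltaA P 1)) one_pos

/-- `dist(suppt f, b)` in the rescaled distance `κ·dist` is `κ·dist(suppt f, b)` (`κ ≥ 0`). [folklore] -/
private theorem suppDist_smul' {α β : Type*} {dist : α → β → ℝ} {κ : ℝ} (hκ : 0 ≤ κ) (f : α → ℝ) (b : β) :
    suppDist (fun a b => κ * dist a b) f b = κ * suppDist dist f b := by
  unfold suppDist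
  rw [Real.mul_iInf_of_nonneg hκ]

/-- the operator of the `η^d`-weighted kernel is linear in the kernel: `(η^d(K − K′))f = (η^dK)f − (η^dK′)f`. [folklore] -/
private theorem applyK_weight_sub {α β : Type*} [Fintype α] (w : ℝ) (K K' : β → α → ℝ) (f : α → ℝ) (b : β) :
    applyK (fun b a => w * (K b a - K' b a)) f b = applyK (fun b a => w * K b a) f b - applyK (fun b a => w * K' b a) f b := by
  unfold applyK
  rw [← Finset.sum_sub_distrib]
  exact Finset.sum_congr rfl fun a _ => by ring

/-- **r18's TYPED (2.31) SHAPE INHABITED BY THE CONCRETE `𝒟_{k,loc}`, `𝒟_k` ON EVERY TORUS, NO HYPOTHESIS**: there are `ρ_* , κ, c > 0` such that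
for every `k ≤ m + K` and every positive schedule non-increasing below `k` with `ρ_k ≥ ρ_*`,
`OpClose231 (κ·dist_k) ⊤ (η_k^d𝒟_{k,loc}) (η_k^d𝒟_k) c ρ_k` — `|(𝒟_{k,loc}f − 𝒟_kf)(b)| ≤ e^{−cρ_k}e^{−c·κdist_k(suppt f,b)}‖f‖_∞` for all `f, b`
(the prefactor `c₀` absorbed by `e^{−(c′/2)ρ_k}` beyond `ρ_*`). [cite: BalabanImbrieJaffe1988, (2.31) p.263] -/
theorem opClose231_dkLoc_torus (hd : 2 ≤ P.d) :
    ∃ ρs κ c : ℝ, 0 < κ ∧ 0 < c ∧ ∀ (k : ℕ) (_ : k ≤ P.m + P.K) (ρ : ℕ → ℝ),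
      (∀ j < k, 0 < ρ j) → (∀ j < k, ρ k ≤ ρ j) → ρs ≤ ρ k →
        OpClose231 (fun a b => κ * kdist (P := P) k a b) (fun _ => True)
          (fun b b'' => (P.eta k) ^ P.d * dkLocKer (P := P) ((P.eta k) ^ P.d) ((P.L : ℝ) ^ k) ρ k b b'')
          (fun b b'' => (P.eta k) ^ P.d * DkE P ((P.eta k) ^ P.d) ((P.L : ℝ) ^ k) k (toE P (Pi.single b'' 1)) b) c (ρ k) := by
  obtain ⟨c₀, c, δ', hc, hδ', hc₀, hall⟩ := opClose_dkLoc_torus (P := P) hd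
  -- beyond `ρ_* := 2·log(1 + c₀)/c` the prefactor is absorbed: `c₀e^{−cρ} ≤ e^{−(c/2)ρ}`
  refine ⟨2 * Real.log (1 + c₀) / c, δ' / min (c / 2) δ', min (c / 2) δ', div_pos hδ' (lt_min (half_pos hc) hδ'),
    lt_min (half_pos hc) hδ', fun k hk ρ hρ hmono hρs f b _ => ?_⟩
  have hm : 0 < min (c / 2) δ' := lt_min (half_pos hc) hδ'
  have hκ : 0 ≤ δ' / min (c / 2) δ' := (div_pos hδ' hm).le
  have h := hall k hk ρ hρ hmono f b
  rw [applyK_weight_sub] at h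
  rw [abs_sub_comm, suppDist_smul' hκ]
  refine h.trans ?_
  have hsN : 0 ≤ supNorm f := supNorm_nonneg f
  have hsD : 0 ≤ suppDist (fun a b => kdist (P := P) k a b) f b := by
    unfold suppDist
    exact Real.iInf_nonneg fun x => div_nonneg (Nat.cast_nonneg _) (cast_pow_L_pos' k).le
  -- the two exponential factors separately
  have hpre : c₀ * Real.exp (-(c * ρ k)) ≤ Real.exp (-(min (c / 2) δ') * ρ k) := by
    have hlog : Real.log (1 + c₀) ≤ c / 2 * ρ k := by
      have := (div_le_iff₀ hc).1 hρs
      linarith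
    have h1 : c₀ ≤ Real.exp (c / 2 * ρ k) := by
      have h2 : 1 + c₀ ≤ Real.exp (c / 2 * ρ k) := by
        rw [← Real.exp_log (by linarith : (0 : ℝ) < 1 + c₀)]
        exact Real.exp_le_exp.2 hlog
      linarith
    calc c₀ * Real.exp (-(c * ρ k)) ≤ Real.exp (c / 2 * ρ k) * Real.exp (-(c * ρ k)) :=
          mul_le_mul_of_nonneg_right h1 (Real.exp_pos _).le
      _ = Real.exp (-(c / 2) * ρ k) := by rw [← Real.exp_add]; congr 1; ring
      _ ≤ Real.exp (-(min (c / 2) δ') * ρ k) := by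
          refine Real.exp_le_exp.2 ?_
          have hρk : 0 ≤ ρ k := by
            have : 0 ≤ 2 * Real.log (1 + c₀) / c := div_nonneg (by have := Real.log_nonneg (by linarith : (1:ℝ) ≤ 1 + c₀); linarith) hc.le
            linarith
          nlinarith [min_le_left (c / 2) δ']
  have hdec : Real.exp (-δ' * suppDist (fun a b => kdist (P := P) k a b) f b) ≤
      Real.exp (-(min (c / 2) δ') * (δ' / min (c / 2) δ' * suppDist (fun a b => kdist (P := P) k a b) f b)) := by
    refine Real.exp_le_exp.2 (le_of_eq ?_)
    field_simp
  calc c₀ * Real.exp (-(c * ρ k)) * Real.exp (-δ' * suppDist (fun a b => kdist (P := P) k a b) f b) * supNorm f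
      ≤ Real.exp (-(min (c / 2) δ') * ρ k) *
          Real.exp (-(min (c / 2) δ') * (δ' / min (c / 2) δ' * suppDist (fun a b => kdist (P := P) k a b) f b)) * supNorm f :=
        mul_le_mul_of_nonneg_right (mul_le_mul hpre hdec (Real.exp_pos _).le (Real.exp_pos _).le) hsN
    _ = _ := by ring

/-! ## §3  Over all tori: one set of constants, hypothesis-free -/

/-- **OPERATOR CLOSENESS OVER ALL TORI FROM [6I] PROP. 1.2 BY ITS TREE NAME** (`2 ≤ d`, `L` odd `> 1`): ONE `(c₀, c, δ′)` with
`|((𝒟_k − 𝒟_{k,loc})f)(b)| ≤ c₀e^{−cρ_k}e^{−δ′dist_k(suppt f,b)}‖f‖_∞` for EVERY torus (`P.d = d`, `P.L = L`), every `k ≤ m + K`, every positive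
schedule non-increasing below `k`, every `f, b` (p16's all-tori `|H|` member + `H_0 = I`, p09's all-tori `cloc_estimates`).
[cite: BalabanImbrieJaffe1988, (2.13) p.261] -/
theorem opClose_dkLoc_allTori_of_prop12Printed {d L : ℕ} (hd : 2 ≤ d) (hL : Odd L ∧ 1 < L) {a : ℝ} (ha : 0 < a)
    (h12 : B5.Prop12Printed (fun i : {x : Params × ℕ // x.1.d = d ∧ x.1.L = L ∧ 1 ≤ x.2 ∧ x.2 ≤ x.1.m + x.1.K} =>
      settingOf (torusRep i.1.1 i.1.2 (deltaAData i.2.2.2.2 a)) i.1.2)) :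
    ∃ c₀ c δ' : ℝ, 0 < c ∧ 0 < δ' ∧ 0 ≤ c₀ ∧ ∀ (P : Params) (_ : P.d = d) (_ : P.L = L) (k : ℕ) (_ : k ≤ P.m + P.K)
      (ρ : ℕ → ℝ), (∀ j < k, 0 < ρ j) → (∀ j < k, ρ k ≤ ρ j) → ∀ (f : PBond P 0 → ℝ) (b : PBond P 0),
        |applyK (fun b b'' => (P.eta k) ^ P.d * (DkE P ((P.eta k) ^ P.d) ((P.L : ℝ) ^ k) k (toE P (Pi.single b'' 1)) b -
            dkLocKer (P := P) ((P.eta k) ^ P.d) ((P.L : ℝ) ^ k) ρ k b b'')) f b| ≤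
          c₀ * Real.exp (-(c * ρ k)) * Real.exp (-δ' * suppDist (fun a b => kdist (P := P) k a b) f b) * supNorm f := by
  classical
  obtain ⟨δ, M, hδ, hM1, hHall⟩ := exists_absH_le_allTori_of_prop12Printed (le_trans one_le_two hd) hL ha h12
  obtain ⟨MC, δ₀, hMC, hδ₀, HC⟩ := cloc_estimates d L hd
  have hδC : 0 < δ₀ / 2 := half_pos hδ₀
  have hM : 0 ≤ M := zero_le_one.trans hM1
  refine ⟨3 * (M ^ 2 * (MC * (Real.exp (4 * δ₀ * L) * (1 + L) ^ 2)) * (d : ℝ) ^ 3 *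
      (Real.exp (min (δ / 2) (δ₀ / 2) / 2 / 2) * ((2 * (1 + d / (min (δ / 2) (δ₀ / 2) / 2))) ^ d) ^ 3)),
    min (δ / 32) (δ₀ / 2 / 4), min (δ / 2) (δ₀ / 2) / 2, lt_min (by positivity) (by positivity),
    half_pos (lt_min (half_pos hδ) hδC), by positivity, fun P hPd hPL k hk ρ hρ hmono f b => ?_⟩
  subst hPd; subst hPL
  have hH : ∀ (j : ℕ) (hj : j ≤ P.m + P.K), j < k → ∀ (μ ν : Fin P.d) (x : TSite P 0) (y : TSite P j),
      |(torusRep P j (deltaAData hj a)).H (x, μ) (y, ν)| ≤ M * Real.exp (-(δ * distEU P j x y)) := by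
    intro j hj _ μ ν x y
    rcases Nat.eq_zero_or_pos j with hj0 | hj1
    · subst hj0
      exact abs_H_zero_le hj ha hM1 δ μ ν x y
    · exact hHall P rfl rfl j hj1 hj μ ν x y
  have hC : ∀ j < k, (∀ b₁ b₂ : PBond P j, |Cmat P j b₁ b₂| ≤
        MC * (Real.exp (4 * δ₀ * P.L) * (1 + P.L) ^ 2) * Real.exp (-(δ₀ / 2 * (supDist b₁.src b₂.src : ℝ)))) ∧
      (∀ b₁ b₂ : PBond P j, |Cloc P j (ρ j / 4) b₁ b₂| ≤
        MC * (Real.exp (4 * δ₀ * P.L) * (1 + P.L) ^ 2) * Real.exp (-(δ₀ / 2 * (supDist b₁.src b₂.src : ℝ)))) ∧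
      (∀ b₁ b₂ : PBond P j, |Cloc P j (ρ j / 4) b₁ b₂ - Cmat P j b₁ b₂| ≤
        MC * (Real.exp (4 * δ₀ * P.L) * (1 + P.L) ^ 2) * Real.exp (-(δ₀ / 2 / 4 * ρ j)) *
          Real.exp (-(δ₀ / 2 * (supDist b₁.src b₂.src : ℝ)))) :=
    fun j hjk => cSide_of_cloc_estimates hMC hδ₀ (fun R b b' => HC P rfl rfl j inferInstance (by omega) R b b') (ρ j)
  rw [neg_mul]
  exact (abs_apply_dkSubDkLoc_le hd hk ha hδ hδC hM (by positivity) hH ρ hρ hmono (fun j hjk => (hC j hjk).1)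
    (fun j hjk => (hC j hjk).2.1) (fun j hjk => (hC j hjk).2.2) f b).trans (le_of_eq (by ring))

/-- **OPERATOR CLOSENESS OVER ALL TORI, HYPOTHESIS-FREE** (`2 ≤ d`, `L` odd `> 1`): ONE `(c₀, c, δ′)` for every torus (`P.d = d`, `P.L = L`),
every `k ≤ m + K`, every positive schedule non-increasing below `k`, every `f, b` — §3's theorem with [6I] Prop. 1.2 supplied by p19's
`prop12Printed_allTori` (at `a = 1`). [cite: BalabanImbrieJaffe1988, (2.13) p.261] -/
theorem opClose_dkLoc_allTori {d L : ℕ} (hd : 2 ≤ d) (hL : Odd L ∧ 1 < L) :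
    ∃ c₀ c δ' : ℝ, 0 < c ∧ 0 < δ' ∧ 0 ≤ c₀ ∧ ∀ (P : Params) (_ : P.d = d) (_ : P.L = L) (k : ℕ) (_ : k ≤ P.m + P.K)
      (ρ : ℕ → ℝ), (∀ j < k, 0 < ρ j) → (∀ j < k, ρ k ≤ ρ j) → ∀ (f : PBond P 0 → ℝ) (b : PBond P 0),
        |applyK (fun b b'' => (P.eta k) ^ P.d * (DkE P ((P.eta k) ^ P.d) ((P.L : ℝ) ^ k) k (toE P (Pi.single b'' 1)) b -
            dkLocKer (P := P) ((P.eta k) ^ P.d) ((P.L : ℝ) ^ k) ρ k b b'')) f b| ≤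
          c₀ * Real.exp (-(c * ρ k)) * Real.exp (-δ' * suppDist (fun a b => kdist (P := P) k a b) f b) * supNorm f :=
  opClose_dkLoc_allTori_of_prop12Printed hd hL one_pos (prop12Printed_allTori d L one_pos)

end

/-! ## §5  (v1.2) At the PRINTED radius schedule `ρ_j = r(e_j) = |log e_j⁻¹|^r` — the schedule hypotheses discharged

The two schedule hypotheses of §§3–4 (`0 < ρ_j` and `ρ_k ≤ ρ_j` for `j < k`) are displayed there because the printed radii (2.2)–(2.3)
`r(e_j)`, `e_j = (L^jε)^{(4−d)/2}e`, satisfy them only for small charge; r18's `BIJ88CurlyDkLocCloseTorus` v1.2 proves exactly this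
(`rSched_pos_of_le`, `rSched_anti`: for `d ≤ 4`, `r ≥ 0` and `log e_k⁻¹ > 0` the schedule `rSched` is positive and non-increasing up to `k`),
so at the printed schedule the operator closeness holds with the printed smallness factor `e^{−c·r(e_k)}` of (2.7) and of the `w′₁`-display
p. 282, with NO schedule hypothesis left.  Pattern = r18's `close_dkLoc_dk_torus_rSched` (kernel form); here the operator form, all `b`. -/

section RSched

open BIJ88Sect2Statements (eK)
open BIJ88CurlyDkLocCloseTorus (rSched_pos_of_le rSched_anti)

variable {P : Params}

/-- **`𝒟_{k,loc}` IS CLOSE TO `𝒟_k` IN OPERATOR FORM ON EVERY TORUS AT THE PRINTED SCHEDULE `ρ_j = r(e_j)`** (`2 ≤ d ≤ 4`): there are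
`c₀ ≥ 0`, `c, δ′ > 0` such that for every `k ≤ m + K`, every `ε, e > 0`, `r ≥ 0` with `log e_k⁻¹ > 0` (small charge at scale `k`) and all `f, b`:
`|((𝒟_k − 𝒟_{k,loc})f)(b)| ≤ c₀·e^{−c·r(e_k)}·e^{−δ′dist_k(suppt f,b)}‖f‖_∞` (the `η^d`-weighted action of §3, `𝒟_{k,loc}` built on the radii
`r(e_j)`, `j < k`) — §3's `opClose_dkLoc_torus` with both schedule hypotheses supplied by r18's `rSched_pos_of_le` / `rSched_anti`.
[cite: BalabanImbrieJaffe1988, (2.13) p.261 with (2.2)–(2.3) p.260] -/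
theorem opClose_dkLoc_torus_rSched (hd : 2 ≤ P.d) (hd4 : P.d ≤ 4) :
    ∃ c₀ c δ' : ℝ, 0 < c ∧ 0 < δ' ∧ 0 ≤ c₀ ∧ ∀ (k : ℕ) (_ : k ≤ P.m + P.K) (ε e r : ℝ), 0 < ε → 0 < e → 0 ≤ r →
      0 < Real.log (eK (P.L : ℝ) ε e P.d k)⁻¹ → ∀ (f : PBond P 0 → ℝ) (b : PBond P 0),
        |applyK (fun b b'' => (P.eta k) ^ P.d * (DkE P ((P.eta k) ^ P.d) ((P.L : ℝ) ^ k) k (toE P (Pi.single b'' 1)) b -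
            dkLocKer (P := P) ((P.eta k) ^ P.d) ((P.L : ℝ) ^ k) (rSched (P.L : ℝ) ε e r P.d) k b b'')) f b| ≤
          c₀ * Real.exp (-(c * rSched (P.L : ℝ) ε e r P.d k)) *
            Real.exp (-δ' * suppDist (fun a b => kdist (P := P) k a b) f b) * supNorm f := by
  obtain ⟨c₀, c, δ', hc, hδ', hc₀, H⟩ := opClose_dkLoc_torus (P := P) hd
  have hL : (1 : ℝ) ≤ P.L := by exact_mod_cast P.hL.2.le
  exact ⟨c₀, c, δ', hc, hδ', hc₀, fun k hk ε e r hε he hr hℓ f b =>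
    H k hk _ (fun j hj => rSched_pos_of_le hL hε he hd4 hj.le hℓ) (fun j hj => rSched_anti hL hε he hr hd4 hj.le hℓ) f b⟩

/-- **THE SAME OVER ALL TORI — ONE SET OF CONSTANTS, NO HYPOTHESIS** (`2 ≤ d ≤ 4`, `L` odd `> 1`): ONE `(c₀, c, δ′)` for EVERY torus `P`
(`P.d = d`, `P.L = L`), every `k ≤ m + K`, every `ε, e > 0`, `r ≥ 0` with `log e_k⁻¹ > 0`, every `f, b` — §4's `opClose_dkLoc_allTori` at the
printed schedule (the printed uniformity «uniformly in k» and in the volume, with the printed smallness `e^{−c·r(e_k)}`).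
[cite: BalabanImbrieJaffe1988, (2.13) p.261 with (2.2)–(2.3) p.260] -/
theorem opClose_dkLoc_allTori_rSched {d L : ℕ} (hd : 2 ≤ d) (hd4 : d ≤ 4) (hL : Odd L ∧ 1 < L) :
    ∃ c₀ c δ' : ℝ, 0 < c ∧ 0 < δ' ∧ 0 ≤ c₀ ∧ ∀ (P : Params) (_ : P.d = d) (_ : P.L = L) (k : ℕ) (_ : k ≤ P.m + P.K)
      (ε e r : ℝ), 0 < ε → 0 < e → 0 ≤ r → 0 < Real.log (eK (P.L : ℝ) ε e P.d k)⁻¹ →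
      ∀ (f : PBond P 0 → ℝ) (b : PBond P 0),
        |applyK (fun b b'' => (P.eta k) ^ P.d * (DkE P ((P.eta k) ^ P.d) ((P.L : ℝ) ^ k) k (toE P (Pi.single b'' 1)) b -
            dkLocKer (P := P) ((P.eta k) ^ P.d) ((P.L : ℝ) ^ k) (rSched (P.L : ℝ) ε e r P.d) k b b'')) f b| ≤
          c₀ * Real.exp (-(c * rSched (P.L : ℝ) ε e r P.d k)) *
            Real.exp (-δ' * suppDist (fun a b => kdist (P := P) k a b) f b) * supNorm f := by
  obtain ⟨c₀, c, δ', hc, hδ', hc₀, H⟩ := opClose_dkLoc_allTori hd hL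
  refine ⟨c₀, c, δ', hc, hδ', hc₀, fun P hPd hPL k hk ε e r hε he hr hℓ f b => ?_⟩
  have hL1 : (1 : ℝ) ≤ P.L := by exact_mod_cast P.hL.2.le
  have hd4' : P.d ≤ 4 := hPd ▸ hd4
  exact H P hPd hPL k hk _ (fun j hj => rSched_pos_of_le hL1 hε he hd4' hj.le hℓ)
    (fun j hj => rSched_anti hL1 hε he hr hd4' hj.le hℓ) f b

end RSched

end Literature.MathematicalPhysics.QuantumFieldTheory.BalabanImbrieJaffe1984to88.BIJ88OpCloseDkLocTorus
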